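import Summits.QuantumAdvantage.QuantumAdvantage.Theorems.HankelLiftBeyondRectanglesStaircase
import Summits.QuantumAdvantage.QuantumAdvantage.Theorems.HankelLiftDiscToRules

/-!
# Communication-type rungs for the lifted Liouville witness `λ(x+y+2)`: rectangle partitions
# (protocol leaves) and the `MAJ ∘ THR` rung

Route `route-QuantumAdvantage-HankelLift`; support of its open hypothesis-type crux
`HankelLift.BeyondRectangles` (stmt-QuantumAdvantage-18440) — the UNCONDITIONAL layer-2 rungs
"MajMajRung / BPP^cc = ω(log n)" of the route's two-layer plan (children of the proved crux
`HankelDiscrepancy`), the circuit rung in a stronger form: bottom gates may be ARBITRARY thresholds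
of a row function plus a column function.

* `rectanglePartition_agree_le` — for every `C`, for all large `n`: a predictor constant on the
  parts of a partition of `[2^n]²` into `R` rectangles (leaves of a deterministic protocol with
  `log₂ R` bits; cells of a product-partition rule) agrees with `[λ(x+y+2) = −1]` on at most
  `4^n/2 + R·4^n/(2n^C)` pairs (`DiscToRules` for arbitrary rectangle partitions and every `C`).

* `discriminator_ineq` — the Hajnal–Maass–Pudlák–Szegedy–Turán discriminator lemma in the summed
  form used here: if an integer threshold gate `[w₀ ≤ ∑ᵢ wᵢ·[gᵢ]]` over `±1`-valued data `F` fires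
  exactly where `F = −1`, then `#points ≤ 2·∑ᵢ |wᵢ|·|∑_{gᵢ} F| + |2w₀ − 1|·|∑ F|`.
* `liouville_pair_not_majThr` — for every `c`, for all large `n`, NO depth-2 circuit whose top gate
  is an integer threshold gate with weights `|wᵢ| ≤ n^c` (threshold `w₀` arbitrary) over `s ≤ n^c`
  bottom gates `gᵢ(x,y) = [tᵢ ≤ aᵢ(x) + bᵢ(y)]` (`aᵢ, bᵢ` arbitrary real functions on `[2^n]`)
  computes `[λ(x+y+2) = −1]` on all of `[2^n]²`; `liouville_pair_not_majLtf` is the reading with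
  real-weight linear threshold gates of the `2n` input bits (the class `MAJ ∘ THR`).
  Input: the staircase discrepancy `hankel_staircase_discrepancy` (Davenport + Parseval + dyadic
  chaining).  Pattern of proof: Jukna 2012, §11.10, Discriminator Lemma and Thm 11.37 (Hajnal et
  al. 1993, `IP_n ∉ MAJ ∘ THR`), with Lindsey's lemma replaced by the Liouville Hankel bound.

Not here: the sign-rank / `THR ∘ MAJ` rung (needs Forster's theorem), and the hypothesis itself
(open: these are worst-case lower bounds against a restricted class; `BeyondRectangles` is
average-case hardness against all PPT).
-/

set_option linter.dupNamespace false -- D-0017: single-problem summit ⇒ `QuantumAdvantage.QuantumAdvantage` by design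

noncomputable section

namespace Summit.QuantumAdvantage.QuantumAdvantage.Theorems.HankelLift

open Finset Real Filter ArithmeticFunction

/-! ## Rectangle partitions (protocol leaves) -/

/-- **Rectangle-partition (protocol) rung.**  For every `C`, for all large `n`: if `[2^n]²` is
partitioned into `R` combinatorial rectangles — a labeling `r : [2^n]² → [R]` each of whose fibers
is a rectangle `S_i × T_i`, e.g. the leaves of a deterministic two-party protocol with
`log₂ R` bits of communication, or the `k²` cells of a `k`-label product-partition rule — then every
predictor that is constant on the parts, `(x,y) ↦ e(r(x,y))`, agrees with `[λ(x+y+2) = −1]` on at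
most `4^n/2 + R·4^n/(2n^C)` pairs.  (So a protocol needs `ω(log n)` bits to predict `λ(x+y+2)` with
constant advantage: the randomized/deterministic communication rung of the route.)  Proof as for
`DiscToRules`: `2·#agree = 4^n + ∑_i ε_i ∑_{S_i×T_i} λ`, each inner sum `≤ 4^n/n^C` by
`HankelDiscrepancy` (`hankelDiscrepancy_proof`). [cite: KushilevitzNisan1996, §3.5 (discrepancy)] -/
theorem rectanglePartition_agree_le (C : ℕ) : ∀ᶠ n : ℕ in atTop,
    ∀ (R : ℕ) (r : Fin (2 ^ n) × Fin (2 ^ n) → Fin R) (e : Fin R → Bool),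
      (∀ i : Fin R, ∃ S T : Finset (Fin (2 ^ n)), ∀ p, r p = i ↔ p.1 ∈ S ∧ p.2 ∈ T) →
      2 * (((Finset.univ.filter fun p : Fin (2 ^ n) × Fin (2 ^ n) =>
          e (r p) = decide (liouville (p.1.val + p.2.val + 2) = -1)).card : ℝ)) ≤
        (4 : ℝ) ^ n + R * ((4 : ℝ) ^ n / (n : ℝ) ^ C) := by
  filter_upwards [hankelDiscrepancy_proof C] with n hn R r e hrect
  classical
  have hcardU : ((Finset.univ : Finset (Fin (2 ^ n) × Fin (2 ^ n))).card : ℝ) = (4 : ℝ) ^ n := by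
    rw [Finset.card_univ, Fintype.card_prod, Fintype.card_fin]
    push_cast
    rw [← mul_pow]
    norm_num
  -- `2·#agree = 4^n + ∑ ε λ`
  have h1 : 2 * (((Finset.univ.filter fun p : Fin (2 ^ n) × Fin (2 ^ n) =>
      e (r p) = decide (liouville (p.1.val + p.2.val + 2) = -1)).card : ℝ)) = (4 : ℝ) ^ n +
      ∑ p : Fin (2 ^ n) × Fin (2 ^ n), (if e (r p) then (-1 : ℝ) else 1) *
        ((liouville (p.1.val + p.2.val + 2) : ℤ) : ℝ) := by
    rw [Finset.card_filter]
    push_cast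
    rw [Finset.mul_sum, ← hcardU, Finset.card_eq_sum_ones]
    push_cast
    rw [← Finset.sum_add_distrib]
    refine Finset.sum_congr rfl fun p _ => ?_
    exact two_mul_ite_agree_eq _ (by omega)
  -- group by the parts
  have h2 : ∑ p : Fin (2 ^ n) × Fin (2 ^ n), (if e (r p) then (-1 : ℝ) else 1) *
        ((liouville (p.1.val + p.2.val + 2) : ℤ) : ℝ) =
      ∑ i : Fin R, (if e i then (-1 : ℝ) else 1) *
        ∑ p ∈ Finset.univ.filter (fun p : Fin (2 ^ n) × Fin (2 ^ n) => r p = i),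
          ((liouville (p.1.val + p.2.val + 2) : ℤ) : ℝ) := by
    rw [← Finset.sum_fiberwise Finset.univ r]
    refine Finset.sum_congr rfl fun i _ => ?_
    rw [Finset.mul_sum]
    refine Finset.sum_congr rfl fun p hp => ?_
    rw [(Finset.mem_filter.mp hp).2]
  -- each part is a rectangle, of discrepancy ≤ 4^n/n^C
  have h3 : ∀ i : Fin R, |∑ p ∈ Finset.univ.filter (fun p : Fin (2 ^ n) × Fin (2 ^ n) => r p = i),
      ((liouville (p.1.val + p.2.val + 2) : ℤ) : ℝ)| ≤ (4 : ℝ) ^ n / (n : ℝ) ^ C := by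
    intro i
    obtain ⟨S, T, hST⟩ := hrect i
    have hfib : (Finset.univ.filter fun p : Fin (2 ^ n) × Fin (2 ^ n) => r p = i) = S ×ˢ T := by
      ext p
      simp only [Finset.mem_filter, Finset.mem_univ, true_and, Finset.mem_product]
      exact hST p
    rw [hfib, Finset.sum_product]
    exact hn S T
  rw [h1, h2]
  have h4 : |∑ i : Fin R, (if e i then (-1 : ℝ) else 1) *
      ∑ p ∈ Finset.univ.filter (fun p : Fin (2 ^ n) × Fin (2 ^ n) => r p = i),
        ((liouville (p.1.val + p.2.val + 2) : ℤ) : ℝ)| ≤ R * ((4 : ℝ) ^ n / (n : ℝ) ^ C) := by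
    refine (Finset.abs_sum_le_sum_abs _ _).trans ?_
    have hcell : ∀ i : Fin R, |(if e i then (-1 : ℝ) else 1) *
        ∑ p ∈ Finset.univ.filter (fun p : Fin (2 ^ n) × Fin (2 ^ n) => r p = i),
          ((liouville (p.1.val + p.2.val + 2) : ℤ) : ℝ)| ≤ (4 : ℝ) ^ n / (n : ℝ) ^ C := by
      intro i
      rw [abs_mul]
      have he : |(if e i then (-1 : ℝ) else 1)| = 1 := by split_ifs <;> simp
      rw [he, one_mul]
      exact h3 i
    refine (Finset.sum_le_sum fun i _ => hcell i).trans (le_of_eq ?_)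
    rw [Finset.sum_const, Finset.card_univ, Fintype.card_fin, nsmul_eq_mul]
  linarith [le_abs_self (∑ i : Fin R, (if e i then (-1 : ℝ) else 1) *
      ∑ p ∈ Finset.univ.filter (fun p : Fin (2 ^ n) × Fin (2 ^ n) => r p = i),
        ((liouville (p.1.val + p.2.val + 2) : ℤ) : ℝ))]


/-! ## The discriminator lemma and the `MAJ ∘ THR` rung -/

/-- **Discriminator lemma (summed form).**  Let `F` be `±1`-valued on a finite index set, `gᵢ`
decidable predicates ("bottom gates"), `wᵢ ∈ ℤ` weights and `w₀ ∈ ℤ` a threshold such that the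
top gate `[w₀ ≤ ∑ᵢ wᵢ·[gᵢ]]` fires exactly where `F = −1`.  Then
`#points ≤ 2·∑ᵢ |wᵢ|·|∑_{gᵢ} F| + |2w₀ − 1|·|∑ F|`
(pointwise `−F·(2(∑ᵢ wᵢ[gᵢ] − w₀) + 1) ≥ 1`, the margin of an integer gate being `≥ 1`; sum and
regroup by gates).  This is the Hajnal–Maass–Pudlák–Szegedy–Turán `ε`-discriminator lemma in the
form "some bottom gate, or the constant, correlates with `F`".
[cite: Jukna2012, §11.10 Discriminator Lemma (p. 330)] -/
theorem discriminator_ineq {ι : Type*} [Fintype ι] {s : ℕ} (F : ι → ℝ)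
    (hF : ∀ p, F p = 1 ∨ F p = -1) (g : Fin s → ι → Prop) [∀ i p, Decidable (g i p)]
    (w : Fin s → ℤ) (w₀ : ℤ)
    (hall : ∀ p, (w₀ ≤ ∑ i, if g i p then w i else 0) ↔ F p = -1) :
    (Fintype.card ι : ℝ) ≤ 2 * ∑ i, |(w i : ℝ)| * |∑ p, if g i p then F p else 0|
      + |2 * (w₀ : ℝ) - 1| * |∑ p, F p| := by
  -- the real form of the top gate's sum
  have hcast : ∀ p, ((∑ i, if g i p then w i else 0 : ℤ) : ℝ) =
      ∑ i, if g i p then (w i : ℝ) else 0 := by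
    intro p
    push_cast
    exact Finset.sum_congr rfl fun i _ => by split_ifs <;> simp
  -- pointwise margin
  have hpt : ∀ p, (1 : ℝ) ≤
      -F p * (2 * ((∑ i, if g i p then (w i : ℝ) else 0) - w₀) + 1) := by
    intro p
    by_cases h : w₀ ≤ ∑ i, if g i p then w i else 0
    · have hFp : F p = -1 := (hall p).mp h
      have h' : (w₀ : ℝ) ≤ ∑ i, if g i p then (w i : ℝ) else 0 := by
        rw [← hcast]; exact_mod_cast h
      rw [hFp]; nlinarith
    · have hFp : F p = 1 := by
        rcases hF p with h1 | h1
        · exact h1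
        · exact absurd ((hall p).mpr h1) h
      rw [not_le] at h
      have h' : (∑ i, if g i p then (w i : ℝ) else 0) + 1 ≤ w₀ := by
        have h2 : (∑ i, if g i p then w i else 0) + 1 ≤ w₀ := Int.add_one_le_iff.mpr h
        rw [← hcast]; exact_mod_cast h2
      rw [hFp]; nlinarith
  -- sum over the points and regroup
  have hsum : (Fintype.card ι : ℝ) ≤
      ∑ p, -F p * (2 * ((∑ i, if g i p then (w i : ℝ) else 0) - w₀) + 1) := by
    calc (Fintype.card ι : ℝ) = ∑ p : ι, (1 : ℝ) := by simp
      _ ≤ _ := Finset.sum_le_sum fun p _ => hpt p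
  have hre : ∑ p, -F p * (2 * ((∑ i, if g i p then (w i : ℝ) else 0) - w₀) + 1) =
      -2 * ∑ i, (w i : ℝ) * (∑ p, if g i p then F p else 0) + (2 * w₀ - 1) * ∑ p, F p := by
    have hp : ∀ p, -F p * (2 * ((∑ i, if g i p then (w i : ℝ) else 0) - w₀) + 1) =
        -2 * ∑ i, (w i : ℝ) * (if g i p then F p else 0) + (2 * w₀ - 1) * F p := by
      intro p
      have hi : ∑ i, (w i : ℝ) * (if g i p then F p else 0) =
          F p * ∑ i, if g i p then (w i : ℝ) else 0 := by
        rw [Finset.mul_sum]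
        refine Finset.sum_congr rfl fun i _ => ?_
        split_ifs <;> ring
      rw [hi]; ring
    rw [Finset.sum_congr rfl fun p _ => hp p, Finset.sum_add_distrib, ← Finset.mul_sum,
      ← Finset.mul_sum, Finset.sum_comm]
    congr 2
    exact Finset.sum_congr rfl fun i _ => by rw [Finset.mul_sum]
  rw [hre] at hsum
  -- absolute values
  have h1 : -2 * ∑ i, (w i : ℝ) * (∑ p, if g i p then F p else 0) ≤
      2 * ∑ i, |(w i : ℝ)| * |∑ p, if g i p then F p else 0| := by
    have h := Finset.abs_sum_le_sum_abs (fun i => (w i : ℝ) * ∑ p, if g i p then F p else 0)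
      Finset.univ
    simp only [abs_mul] at h
    have h' := neg_abs_le (∑ i, (w i : ℝ) * ∑ p, if g i p then F p else 0)
    linarith
  have h2 : (2 * (w₀ : ℝ) - 1) * ∑ p, F p ≤ |2 * (w₀ : ℝ) - 1| * |∑ p, F p| := by
    rw [← abs_mul]; exact le_abs_self _
  linarith

/-- Clipping the threshold of an integer threshold gate to `[−(W+1), W+1]`, `W` a bound for the
weighted sum, does not change the gate. [folklore] -/
theorem le_iff_clip_le {W X w₀ : ℤ} (hX : |X| ≤ W) :
    w₀ ≤ X ↔ max (-(W + 1)) (min (W + 1) w₀) ≤ X := by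
  obtain ⟨h1, h2⟩ := abs_le.mp hX
  constructor
  · intro h
    exact max_le (by omega) ((min_le_right _ _).trans h)
  · intro h
    have hmin : min (W + 1) w₀ ≤ X := (le_max_right _ _).trans h
    rcases le_or_gt w₀ (W + 1) with hw | hw
    · rwa [min_eq_right hw] at hmin
    · rw [min_eq_left hw.le] at hmin; omega

/-- **The `MAJ ∘ THR` rung for the lifted Liouville witness (unconditional).**  For every `c`, for
all large `n`: for every `s ≤ n^c`, all real `aᵢ, bᵢ : [2^n] → ℝ`, `tᵢ : ℝ` (bottom gates
`gᵢ(x,y) = [tᵢ ≤ aᵢ(x) + bᵢ(y)]`, ARBITRARY thresholds of a row function plus a column function),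
all integer top weights `|wᵢ| ≤ n^c` and every integer threshold `w₀`, the depth-2 circuit
`[w₀ ≤ ∑ᵢ wᵢ gᵢ(x,y)]` differs from `[λ(x+y+2) = −1]` at some `(x,y) ∈ [2^n]²`.
Proof: clip `w₀` (`le_iff_clip_le`), apply `discriminator_ineq`, and bound every gate sum and the
constant sum by the staircase discrepancy `4^n/n^{2c+1}` (`hankel_staircase_discrepancy`):
`4^n ≤ (4·s·n^c + 3)·4^n/n^{2c+1} < 4^n` for `n ≥ 8`.  The method is Nisan's / HMPST's
(`MAJ ∘ THR` lower bounds from the discriminator lemma plus low discrepancy of threshold gates);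
the statement for this arithmetic witness is the route's rung.
[cite: Jukna2012, §11.10 Thm 11.37 (pattern of proof; there for `IP_n`)] -/
theorem liouville_pair_not_majThr (c : ℕ) : ∀ᶠ n : ℕ in atTop, ∀ s : ℕ, s ≤ n ^ c →
    ∀ (a b : Fin s → Fin (2 ^ n) → ℝ) (t : Fin s → ℝ) (w : Fin s → ℤ) (w₀ : ℤ),
      (∀ i, |w i| ≤ (n : ℤ) ^ c) →
      ∃ p : Fin (2 ^ n) × Fin (2 ^ n),
        decide (w₀ ≤ ∑ i, if t i ≤ a i p.1 + b i p.2 then w i else 0) ≠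
          decide (liouville (p.1.val + p.2.val + 2) = -1) := by
  filter_upwards [hankel_staircase_discrepancy (2 * c + 1), eventually_ge_atTop 8] with
    n hdisc hn8 s hs a b t w w₀ hw
  by_contra hall
  push Not at hall
  -- notation
  set F : Fin (2 ^ n) × Fin (2 ^ n) → ℝ := fun p => ((liouville (p.1.val + p.2.val + 2) : ℤ) : ℝ)
    with hFdef
  set δ : ℝ := (4 : ℝ) ^ n / (n : ℝ) ^ (2 * c + 1) with hδdef
  have hF : ∀ p, F p = 1 ∨ F p = -1 := by
    intro p
    simp only [hFdef]
    rw [liouville_apply (by omega)]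
    rcases neg_one_pow_eq_or ℤ (cardFactors (p.1.val + p.2.val + 2)) with h | h <;> simp [h]
  -- the weighted sums are bounded by `W = ∑ |wᵢ|`
  set W : ℤ := ∑ i, |w i| with hWdef
  have hX : ∀ p : Fin (2 ^ n) × Fin (2 ^ n),
      |∑ i, (if t i ≤ a i p.1 + b i p.2 then w i else 0)| ≤ W := by
    intro p
    refine (Finset.abs_sum_le_sum_abs _ _).trans (Finset.sum_le_sum fun i _ => ?_)
    split_ifs <;> simp
  -- clip the threshold
  set w₀' : ℤ := max (-(W + 1)) (min (W + 1) w₀) with hw₀'def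
  have hw₀' : |w₀'| ≤ W + 1 := by
    have hW0 : 0 ≤ W := Finset.sum_nonneg fun i _ => abs_nonneg _
    exact abs_le.mpr ⟨le_max_left _ _, max_le (by omega) (min_le_left _ _)⟩
  have hall' : ∀ p : Fin (2 ^ n) × Fin (2 ^ n),
      (w₀' ≤ ∑ i, if t i ≤ a i p.1 + b i p.2 then w i else 0) ↔ F p = -1 := by
    intro p
    have h := hall p
    rw [decide_eq_decide] at h
    refine (le_iff_clip_le (hX p)).symm.trans (h.trans ⟨fun h1 => ?_, fun h1 => ?_⟩)
    · simp [hFdef, h1]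
    · simp only [hFdef] at h1
      exact_mod_cast h1
  -- the discriminator inequality
  have hD := discriminator_ineq F hF (fun i p => t i ≤ a i p.1 + b i p.2) w w₀' hall'
  -- the staircase bounds
  have hgate : ∀ i, |∑ p : Fin (2 ^ n) × Fin (2 ^ n),
      (if t i ≤ a i p.1 + b i p.2 then F p else 0)| ≤ δ := by
    intro i
    rw [Fintype.sum_prod_type]
    exact hdisc (a i) (b i) (t i)
  have hconst : |∑ p : Fin (2 ^ n) × Fin (2 ^ n), F p| ≤ δ := by
    have h := hdisc (fun _ => (0 : ℝ)) (fun _ => 0) 0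
    simp only [add_zero, le_refl, if_true] at h
    rwa [Fintype.sum_prod_type]
  -- numerics
  have hcard : (Fintype.card (Fin (2 ^ n) × Fin (2 ^ n)) : ℝ) = (4 : ℝ) ^ n := by
    rw [Fintype.card_prod, Fintype.card_fin]
    push_cast
    rw [← mul_pow]; norm_num
  have hWle : (W : ℝ) ≤ s * (n : ℝ) ^ c := by
    have h : W ≤ ∑ _i : Fin s, (n : ℤ) ^ c := Finset.sum_le_sum fun i _ => hw i
    rw [Finset.sum_const, Finset.card_univ, Fintype.card_fin, nsmul_eq_mul] at h
    exact_mod_cast h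
  have hδ0 : 0 ≤ δ := by positivity
  have hT1 : ∑ i, |(w i : ℝ)| * |∑ p : Fin (2 ^ n) × Fin (2 ^ n),
      (if t i ≤ a i p.1 + b i p.2 then F p else 0)| ≤ s * (n : ℝ) ^ c * δ := by
    calc ∑ i, |(w i : ℝ)| * |∑ p : Fin (2 ^ n) × Fin (2 ^ n),
          (if t i ≤ a i p.1 + b i p.2 then F p else 0)|
        ≤ ∑ i, |(w i : ℝ)| * δ :=
          Finset.sum_le_sum fun i _ => mul_le_mul_of_nonneg_left (hgate i) (abs_nonneg _)
      _ = (W : ℝ) * δ := by rw [← Finset.sum_mul, hWdef]; push_cast; rfl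
      _ ≤ s * (n : ℝ) ^ c * δ := mul_le_mul_of_nonneg_right hWle hδ0
  have hthr : |2 * (w₀' : ℝ) - 1| ≤ 2 * (s * (n : ℝ) ^ c) + 3 := by
    have h1 : |(w₀' : ℝ)| ≤ W + 1 := by exact_mod_cast hw₀'
    calc |2 * (w₀' : ℝ) - 1| ≤ |2 * (w₀' : ℝ)| + |(1 : ℝ)| := abs_sub _ _
      _ = 2 * |(w₀' : ℝ)| + 1 := by rw [abs_mul]; norm_num
      _ ≤ 2 * (s * (n : ℝ) ^ c) + 3 := by linarith
  have hT2 : |2 * (w₀' : ℝ) - 1| * |∑ p : Fin (2 ^ n) × Fin (2 ^ n), F p| ≤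
      (2 * (s * (n : ℝ) ^ c) + 3) * δ :=
    mul_le_mul hthr hconst (abs_nonneg _) (by positivity)
  have hs' : (s : ℝ) ≤ (n : ℝ) ^ c := by exact_mod_cast hs
  have hn8' : (8 : ℝ) ≤ n := by exact_mod_cast hn8
  -- `4^n ≤ (4 n^{2c} + 3) δ`
  have hmain : (4 : ℝ) ^ n ≤ (4 * (n : ℝ) ^ (2 * c) + 3) * δ := by
    have h2c : (n : ℝ) ^ c * (n : ℝ) ^ c = (n : ℝ) ^ (2 * c) := by rw [← pow_add]; ring_nf
    rw [hcard] at hD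
    have hsn : (s : ℝ) * (n : ℝ) ^ c * δ ≤ (n : ℝ) ^ (2 * c) * δ := by
      rw [← h2c]
      exact mul_le_mul_of_nonneg_right (mul_le_mul_of_nonneg_right hs' (by positivity)) hδ0
    linarith
  -- `(4 n^{2c} + 3) δ < 4^n` for `n ≥ 8`
  have hlt : (4 * (n : ℝ) ^ (2 * c) + 3) * δ < (4 : ℝ) ^ n := by
    rw [hδdef, pow_succ, ← mul_div_assoc, div_lt_iff₀ (by positivity)]
    have hX1 : (1 : ℝ) ≤ (n : ℝ) ^ (2 * c) := one_le_pow₀ (by linarith)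
    have h4 : (0 : ℝ) < (4 : ℝ) ^ n := by positivity
    have hpos : (0 : ℝ) < (n : ℝ) ^ (2 * c) * n - (4 * (n : ℝ) ^ (2 * c) + 3) := by
      nlinarith [mul_le_mul_of_nonneg_left hn8' (by positivity : (0 : ℝ) ≤ (n : ℝ) ^ (2 * c))]
    nlinarith [mul_pos h4 hpos]
  exact absurd (hmain.trans_lt hlt) (lt_irrefl _)

/-- **The `MAJ ∘ LTF` form** (bottom gates read the bits): for every `c`, for all large `n`, no
depth-2 circuit `[w₀ ≤ ∑ᵢ wᵢ gᵢ]` with integer top weights `|wᵢ| ≤ n^c`, `s ≤ n^c` gates, each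
`gᵢ` a linear threshold gate `[θᵢ ≤ ∑ₖ uᵢₖ xₖ + ∑ₖ vᵢₖ yₖ]` with ARBITRARY real weights of the `2n`
input bits `xₖ = bitₖ(x)`, `yₖ = bitₖ(y)`, computes `[λ(x+y+2) = −1]` on `[2^n]²`
(`liouville_pair_not_majThr` with `aᵢ(x) = ∑ₖ uᵢₖ xₖ`, `bᵢ(y) = ∑ₖ vᵢₖ yₖ`).
[cite: Jukna2012, §11.10 Thm 11.37 (pattern of proof; there for `IP_n`)] -/
theorem liouville_pair_not_majLtf (c : ℕ) : ∀ᶠ n : ℕ in atTop, ∀ s : ℕ, s ≤ n ^ c →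
    ∀ (u v : Fin s → Fin n → ℝ) (θ : Fin s → ℝ) (w : Fin s → ℤ) (w₀ : ℤ),
      (∀ i, |w i| ≤ (n : ℤ) ^ c) →
      ∃ p : Fin (2 ^ n) × Fin (2 ^ n),
        decide (w₀ ≤ ∑ i, if θ i ≤ (∑ k : Fin n, if Nat.testBit p.1.val k then u i k else 0) +
            (∑ k : Fin n, if Nat.testBit p.2.val k then v i k else 0) then w i else 0) ≠
          decide (liouville (p.1.val + p.2.val + 2) = -1) := by
  filter_upwards [liouville_pair_not_majThr c] with n hn s hs u v θ w w₀ hw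
  exact hn s hs (fun i x => ∑ k : Fin n, if Nat.testBit x.val k then u i k else 0)
    (fun i y => ∑ k : Fin n, if Nat.testBit y.val k then v i k else 0) θ w w₀ hw

end Summit.QuantumAdvantage.QuantumAdvantage.Theorems.HankelLift
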